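import Literature.NumberTheory.Sieve.HeathBrownCubicTypeIIOffDiag
import Literature.NumberTheory.Sieve.HeathBrownCubicLemma45Pow
import Literature.NumberTheory.Sieve.DivisorPowerSums
import Mathlib.Analysis.MeanInequalities
import HarnessLib

/-!
# Heath-Brown's Lemma 3.10, §12 pp. 75–77: the pairs with a large h.c.f. (the tail `dD > d₀`)

Support for the proof of **Lemma 3.10** of D. R. Heath-Brown, *Primes represented by `x³ + 2y³`*,
Acta Math. 186 (2001), §12 pp. 75–77:

> "We proceed to pick out the condition h.c.f.(v₁, v₂, v₃) = D by using the Möbius function. … Thus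
> if `Dd | v` we have `τ(v) = O(X^ε)` unless `Dd ≪ V^{2/3}`. … Large values of `dD` will make a
> negligible contribution. To handle the range `H < dD ≤ 2H`, say, we write `v = rw` for some primitive
> `w`. … each `βᵢ` lies on a certain 2-dimensional lattice … Since `ABC ≤ (A³ + B³ + C³)/3` for any
> positive numbers `A, B, C`, we deduce that `S₆(H, w) ≪ (log X)^{2c} ∑ τ(γ)⁶` … We may now sum up over
> the available ranges `(H, 2H]` with `H ≥ d₀` to get a bound `O(VXY⁻¹⁵(log X)^c)`."

We PROVE a global form of this tail estimate, with Lemma 4.8 (reduced bases) and Lemma 4.6 replaced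
by the fibred plane count `card_filter_dot_eq_zero_le` of `HeathBrownCubicLatticeGeometry`:

* `young_abc_sq`: `abc² ≤ (a³ + b³ + c⁶)/3`;
* `exists_prim_perp`: a primitive `c ⊥ b` with `|c|_∞ ≤ |b|_∞`; `card_perp_box_le`: `#{α̂ ⊥ β̂₁, |α̂|_∞ ≤ U}
  ≤ 16U²/|β̂₁|_∞ + 10U + 1`; `sum_inv_supZ_perp_le`: the dyadic bound `∑_{α̂ ⊥ β̂₁, |α̂| ≤ W} |α̂|⁻¹
  ≤ 512W/T + 40 log W + 42` (`|β̂₁|_∞ > T/4`);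
* `Gset`, `TLset`, `TL` — the pairs `(β̂₁, β̂₂)` of primitive vectors of the box with `|β̂ᵢ|_∞ > T/4`,
  `β̂₁ ≠ β̂₂` and `h.c.f.(β̂₁ ∧ β̂₂) > d₀`, weighted by `τ(β₁)τ(β₂)τ(h.c.f.)²`;
* **`exists_TL_bound`**: `TL ≤ C (T⁶/d₀ + T⁵)(log T)^e` for `T ≥ 2`, `d₀ ≥ 1`. With `T = V^{1/3}`,
  `d₀ = VY⁷X⁻¹` this is `≪ (VXY⁻⁷ + V^{5/3})(log X)^e`.

## References

* D. R. Heath-Brown, *Primes represented by `x³ + 2y³`*, Acta Math. 186 (2001), §12 pp. 75–77,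
  Lemmas 4.6, 4.8. [cite: HeathBrownActa2001, §12 pp. 75–77]

## Mathlib / tree search

Tree: `HeathBrownCubicLatticeGeometry` (`card_filter_dot_eq_zero_le`, `cross3_eq_smul_of_dot_eq_zero`,
`exists_eq_smul_of_cross3_eq_zero`, `supZ_*`), `HeathBrownCubicTypeIIOffDiag` (`hcf3`, `divVec`,
`isPrimitiveVec_divVec_hcf3`, `hcf3_smul_of_isPrimitiveVec`, `Bbox`), `HeathBrownCubicLemma45Pow`
(`exists_sum_box_idealDivisorCount_pow_le`), `DivisorPowerSums` (`exists_sum_sigma_zero_pow_le_real`);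
Mathlib `Real.geom_mean_le_arith_mean3_weighted`.
-/

noncomputable section

open Finset NumberField ArithmeticFunction

open scoped ArithmeticFunction.sigma

namespace Literature.NumberTheory.Sieve.CubicSieve

open LFunctions.CubeRootTwoField CubicPrimes

/-! ### Young's inequality `abc² ≤ (a³ + b³ + c⁶)/3` -/

/-- **"`ABC ≤ (A³ + B³ + C³)/3`"** in the form used: `abc² ≤ (a³ + b³ + c⁶)/3` for `a, b, c ≥ 0`.
[cite: HeathBrownActa2001, §12 p. 76] -/
theorem young_abc_sq {a b c : ℝ} (ha : 0 ≤ a) (hb : 0 ≤ b) (hc : 0 ≤ c) :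
    a * b * c ^ 2 ≤ (a ^ 3 + b ^ 3 + c ^ 6) / 3 := by
  have h := Real.geom_mean_le_arith_mean3_weighted (w₁ := 1 / 3) (w₂ := 1 / 3) (w₃ := 1 / 3)
    (p₁ := a ^ 3) (p₂ := b ^ 3) (p₃ := c ^ 6) (by norm_num) (by norm_num) (by norm_num)
    (by positivity) (by positivity) (by positivity) (by norm_num)
  have e1 : (a ^ 3) ^ (1 / 3 : ℝ) = a := by
    rw [← Real.rpow_natCast, ← Real.rpow_mul ha]; norm_num
  have e2 : (b ^ 3) ^ (1 / 3 : ℝ) = b := by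
    rw [← Real.rpow_natCast, ← Real.rpow_mul hb]; norm_num
  have e3 : (c ^ 6) ^ (1 / 3 : ℝ) = c ^ 2 := by
    rw [← Real.rpow_natCast, ← Real.rpow_mul hc]; norm_num
  rw [e1, e2, e3] at h
  linarith

/-! ### A primitive vector orthogonal to `b` -/

/-- For `b ≠ 0` there is a primitive `c` with `b · c = 0` and `|c|_∞ ≤ |b|_∞`
(`c = (b₂, −b₁, 0)/(b₁, b₂)` or `(1, 0, 0)`). [folklore] -/
theorem exists_prim_perp {b : ℤ × ℤ × ℤ} (hb : b ≠ 0) :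
    ∃ c : ℤ × ℤ × ℤ, IsPrimitiveVec c ∧ dot3 b c = 0 ∧ supZ c ≤ supZ b := by
  by_cases h12 : b.1 = 0 ∧ b.2.1 = 0
  · refine ⟨(1, 0, 0), fun d h1 _ _ => isUnit_of_dvd_one h1, by simp [dot3, h12.1, h12.2], ?_⟩
    have hb3 : b.2.2 ≠ 0 := by
      intro h3; exact hb (Prod.ext h12.1 (Prod.ext h12.2 h3))
    have e1 : supZ ((1 : ℤ), (0 : ℤ), (0 : ℤ)) = 1 := by simp [supZ]
    have e2 : supZ b = |b.2.2| := by
      simp only [supZ, h12.1, h12.2, abs_zero]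
      rw [max_eq_right (le_max_of_le_right (abs_nonneg _)), max_eq_right (abs_nonneg _)]
    rw [e1, e2]
    exact Int.one_le_abs hb3
  · set g : ℤ := (Int.gcd b.1 b.2.1 : ℤ) with hg
    have hg0 : g ≠ 0 := by
      rw [hg]; exact_mod_cast (Int.gcd_eq_zero_iff.not.mpr h12)
    have hgpos : 0 < g := lt_of_le_of_ne (by rw [hg]; positivity) (Ne.symm hg0)
    obtain ⟨u, hu⟩ : g ∣ b.1 := Int.gcd_dvd_left _ _
    obtain ⟨v, hv⟩ : g ∣ b.2.1 := Int.gcd_dvd_right _ _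
    refine ⟨(v, -u, 0), ?_, ?_, ?_⟩
    · intro d h1 h2 _
      simp only at h1 h2
      have hcop : Int.gcd u v = 1 := by
        have H : 0 < Int.gcd b.1 b.2.1 := Int.gcd_pos_iff.mpr (not_and_or.mp h12)
        have := Int.gcd_div_gcd_div_gcd H
        rw [← hg, hu, hv, Int.mul_ediv_cancel_left _ hg0, Int.mul_ediv_cancel_left _ hg0] at this
        exact this
      have hd : d ∣ (Int.gcd u v : ℤ) := Int.dvd_coe_gcd ((dvd_neg.mp h2)) h1
      rw [hcop] at hd
      exact isUnit_of_dvd_one (by exact_mod_cast hd)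
    · simp only [dot3]; rw [hu, hv]; ring
    · simp only [supZ, abs_neg, abs_zero]
      have h1 : |v| ≤ |b.2.1| := by
        rw [hv, abs_mul]; exact le_mul_of_one_le_left (abs_nonneg _) (Int.one_le_abs hg0)
      have h2 : |u| ≤ |b.1| := by
        rw [hu, abs_mul]; exact le_mul_of_one_le_left (abs_nonneg _) (Int.one_le_abs hg0)
      refine max_le (h1.trans ((le_max_left _ _).trans (le_max_right _ _))) (max_le (h2.trans (le_max_left _ _)) ?_)
      exact (abs_nonneg _).trans (le_max_left _ _)

/-! ### Counting `α̂ ⊥ β̂₁` -/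

open scoped Classical in
/-- **`#{α̂ : β̂₁·α̂ = 0, |α̂|_∞ ≤ U} ≤ 16U²/|β̂₁|_∞ + 10U + 1`** (`β̂₁` primitive): the lattice
`β̂₁^⊥ ∩ ℤ³` fibred along a primitive `c ⊥ β̂₁` with `|c|_∞ ≤ |β̂₁|_∞`. [cite: HeathBrownActa2001, Lemma 4.8] -/
theorem card_perp_box_le {b : ℤ × ℤ × ℤ} (hb : IsPrimitiveVec b) {U : ℝ} (hU : 0 ≤ U) (s : Finset (ℤ × ℤ × ℤ)) :
    (#(s.filter (fun a => dot3 b a = 0 ∧ (|(a.1 : ℝ)| ≤ U ∧ |(a.2.1 : ℝ)| ≤ U ∧ |(a.2.2 : ℝ)| ≤ U))) : ℝ) ≤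
      16 * U ^ 2 / (supZ b : ℝ) + 10 * U + 1 := by
  classical
  obtain ⟨c, hc, hbc, hcb⟩ := exists_prim_perp hb.ne_zero
  have h := card_filter_dot_eq_zero_le hb hc hbc (0, 0, 0) hU s
  simp only [sub_zero] at h
  have hc1 : (1 : ℝ) ≤ supZ c := by exact_mod_cast one_le_supZ hc.ne_zero
  have hb1 : (1 : ℝ) ≤ supZ b := by exact_mod_cast one_le_supZ hb.ne_zero
  have hcbR : (supZ c : ℝ) ≤ supZ b := by exact_mod_cast hcb
  refine h.trans ?_
  have e : (8 * U * (supZ c : ℝ) / (supZ b : ℝ) + 1) * (2 * U / (supZ c : ℝ) + 1) =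
      16 * U ^ 2 / (supZ b : ℝ) + 8 * U * ((supZ c : ℝ) / supZ b) + 2 * U / supZ c + 1 := by
    field_simp
    ring
  rw [e]
  have h1 : (supZ c : ℝ) / supZ b ≤ 1 := (div_le_one (by linarith)).mpr hcbR
  have h2 : 2 * U / (supZ c : ℝ) ≤ 2 * U := div_le_self (by positivity) hc1
  nlinarith

open scoped Classical in
/-- The set of nonzero `α̂ ⊥ β̂₁` with `|α̂|_∞ ≤ W` inside an ambient finite set. [folklore] -/
def perpSet (b : ℤ × ℤ × ℤ) (W : ℝ) (s : Finset (ℤ × ℤ × ℤ)) : Finset (ℤ × ℤ × ℤ) :=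
  s.filter (fun a => dot3 b a = 0 ∧ a ≠ 0 ∧ (supZ a : ℝ) ≤ W)

open scoped Classical in
/-- `#perpSet ≤ 16W²/|β̂₁|_∞ + 10W + 1`. [cite: HeathBrownActa2001, Lemma 4.8] -/
theorem card_perpSet_le {b : ℤ × ℤ × ℤ} (hb : IsPrimitiveVec b) {W : ℝ} (hW : 0 ≤ W) (s : Finset (ℤ × ℤ × ℤ)) :
    (#(perpSet b W s) : ℝ) ≤ 16 * W ^ 2 / (supZ b : ℝ) + 10 * W + 1 := by
  classical
  refine le_trans ?_ (card_perp_box_le hb hW s)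
  refine Nat.cast_le.mpr (card_le_card fun a ha => ?_)
  rw [perpSet, mem_filter] at ha
  rw [mem_filter]
  obtain ⟨h1, h2, h3⟩ := abs_cast_le_supZ a
  exact ⟨ha.1, ha.2.1, h1.trans ha.2.2.2, h2.trans ha.2.2.2, h3.trans ha.2.2.2⟩

open scoped Classical in
/-- **The dyadic harmonic sum over `α̂ ⊥ β̂₁`**: for `|β̂₁|_∞ > T/4` and `W ≥ 1`,
`∑_{α̂ ∈ perpSet} |α̂|_∞⁻¹ ≤ 512W/T + 40 log W + 42`. [cite: HeathBrownActa2001, §12 p. 77] -/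
theorem sum_inv_supZ_perp_le {T : ℝ} (hT : 0 < T) {b : ℤ × ℤ × ℤ} (hb : IsPrimitiveVec b)
    (hsup : T / 4 < (supZ b : ℝ)) {W : ℝ} (hW : 1 ≤ W) (s : Finset (ℤ × ℤ × ℤ)) :
    ∑ a ∈ perpSet b W s, ((supZ a : ℝ))⁻¹ ≤ 512 * W / T + 40 * Real.log W + 42 := by
  classical
  set S := perpSet b W s with hS
  -- shell index
  set kf : ℤ × ℤ × ℤ → ℕ := fun a => Nat.log 2 (supZ a).toNat with hkf
  set K : ℕ := Nat.log 2 ⌊W⌋₊ with hK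
  have hmemS : ∀ a ∈ S, dot3 b a = 0 ∧ a ≠ 0 ∧ (supZ a : ℝ) ≤ W := fun a ha => by
    rw [hS, perpSet, mem_filter] at ha; exact ha.2
  have hsupNat : ∀ a : ℤ × ℤ × ℤ, ((supZ a).toNat : ℤ) = supZ a := fun a => Int.toNat_of_nonneg (supZ_nonneg a)
  have hkK : ∀ a ∈ S, kf a ∈ range (K + 1) := by
    intro a ha
    obtain ⟨-, ha0, haW⟩ := hmemS a ha
    rw [mem_range, Nat.lt_succ_iff, hkf, hK]
    apply Nat.log_mono_right
    apply Nat.le_floor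
    have : (((supZ a).toNat : ℕ) : ℝ) = ((supZ a : ℤ) : ℝ) := by exact_mod_cast hsupNat a
    rw [this]; exact haW
  -- shell bounds: `2^k ≤ |a| < 2^{k+1}`
  have hshell : ∀ a ∈ S, (2 : ℝ) ^ kf a ≤ (supZ a : ℝ) ∧ (supZ a : ℝ) < 2 ^ (kf a + 1) := by
    intro a ha
    obtain ⟨-, ha0, -⟩ := hmemS a ha
    have h1 : 1 ≤ (supZ a).toNat := by
      have := one_le_supZ ha0; omega
    have hlo := Nat.pow_log_le_self 2 (show (supZ a).toNat ≠ 0 by omega)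
    have hhi := Nat.lt_pow_succ_log_self (b := 2) (by norm_num) (supZ a).toNat
    have e : ((supZ a : ℤ) : ℝ) = (((supZ a).toNat : ℕ) : ℝ) := by exact_mod_cast (hsupNat a).symm
    rw [e]
    exact ⟨by exact_mod_cast hlo, by exact_mod_cast hhi⟩
  rw [← sum_fiberwise_of_maps_to hkK]
  have hterm : ∀ k ∈ range (K + 1), ∑ a ∈ S.filter (fun a => kf a = k), ((supZ a : ℝ))⁻¹ ≤
      256 * 2 ^ k / T + 20 + ((2 : ℝ) ^ k)⁻¹ := by
    intro k _
    have hU : (0 : ℝ) ≤ 2 ^ (k + 1) := by positivity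
    calc ∑ a ∈ S.filter (fun a => kf a = k), ((supZ a : ℝ))⁻¹
        ≤ ∑ _a ∈ S.filter (fun a => kf a = k), ((2 : ℝ) ^ k)⁻¹ := by
          refine sum_le_sum fun a ha => ?_
          rw [mem_filter] at ha
          obtain ⟨h1, -⟩ := hshell a ha.1
          rw [ha.2] at h1
          exact inv_anti₀ (by positivity) h1
      _ = #(S.filter (fun a => kf a = k)) * ((2 : ℝ) ^ k)⁻¹ := by rw [sum_const, nsmul_eq_mul]
      _ ≤ (16 * (2 ^ (k + 1)) ^ 2 / (supZ b : ℝ) + 10 * 2 ^ (k + 1) + 1) * ((2 : ℝ) ^ k)⁻¹ := by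
          gcongr
          refine le_trans ?_ (card_perp_box_le hb hU s)
          refine Nat.cast_le.mpr (card_le_card fun a ha => ?_)
          rw [mem_filter] at ha
          obtain ⟨haS, hak⟩ := ha
          have hmem := hmemS a haS
          obtain ⟨-, h2⟩ := hshell a haS
          rw [hak] at h2
          rw [mem_filter]
          obtain ⟨c1, c2, c3⟩ := abs_cast_le_supZ a
          have haS' : a ∈ s := by rw [hS, perpSet, mem_filter] at haS; exact haS.1
          exact ⟨haS', hmem.1, c1.trans h2.le, c2.trans h2.le, c3.trans h2.le⟩
      _ ≤ (16 * (2 ^ (k + 1)) ^ 2 / (T / 4) + 10 * 2 ^ (k + 1) + 1) * ((2 : ℝ) ^ k)⁻¹ := by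
          gcongr
      _ = 256 * 2 ^ k / T + 20 + ((2 : ℝ) ^ k)⁻¹ := by
          field_simp; ring
  refine (sum_le_sum hterm).trans ?_
  rw [sum_add_distrib, sum_add_distrib, sum_const, card_range, nsmul_eq_mul]
  -- geometric sums
  have hgeo1 : ∑ k ∈ range (K + 1), (256 : ℝ) * 2 ^ k / T = 256 / T * ∑ k ∈ range (K + 1), (2 : ℝ) ^ k := by
    rw [mul_sum]; refine sum_congr rfl fun k _ => ?_; ring
  have hgeo2 : ∑ k ∈ range (K + 1), (2 : ℝ) ^ k ≤ 2 * 2 ^ K := by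
    have := geom_sum_eq (x := (2 : ℝ)) (by norm_num) (K + 1)
    rw [this]; rw [pow_succ]; norm_num; nlinarith [pow_pos (by norm_num : (0:ℝ) < 2) K]
  have hgeo3 : ∑ k ∈ range (K + 1), ((2 : ℝ) ^ k)⁻¹ ≤ 2 := by
    have := geom_sum_Ico_le_of_lt_one (x := (1 / 2 : ℝ)) (m := 0) (n := K + 1) (by norm_num) (by norm_num)
    simp only [Finset.range_eq_Ico] at *
    calc ∑ k ∈ Ico 0 (K + 1), ((2 : ℝ) ^ k)⁻¹ = ∑ k ∈ Ico 0 (K + 1), (1 / 2 : ℝ) ^ k := by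
          refine sum_congr rfl fun k _ => ?_; rw [one_div, inv_pow]
      _ ≤ (1 / 2 : ℝ) ^ 0 / (1 - 1 / 2) := this
      _ = 2 := by norm_num
  -- `2^K ≤ W`, `K ≤ log₂ W ≤ 2 log W`
  have hW0 : 0 < W := by linarith
  have h2K : (2 : ℝ) ^ K ≤ W := by
    have h1 : 2 ^ K ≤ ⌊W⌋₊ := by
      rw [hK]; exact Nat.pow_log_le_self 2 (Nat.pos_iff_ne_zero.mp (Nat.floor_pos.mpr hW))
    calc (2 : ℝ) ^ K = ((2 ^ K : ℕ) : ℝ) := by push_cast; ring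
      _ ≤ ⌊W⌋₊ := by exact_mod_cast h1
      _ ≤ W := Nat.floor_le hW0.le
  have hKlog : (K : ℝ) ≤ 2 * Real.log W := by
    have h1 : (K : ℝ) * Real.log 2 ≤ Real.log W := by
      rw [← Real.log_pow]; exact Real.log_le_log (by positivity) h2K
    have hl2 : (1 / 2 : ℝ) < Real.log 2 := by
      have := Real.log_two_gt_d9; linarith
    have hK0 : (0 : ℝ) ≤ K := Nat.cast_nonneg K
    nlinarith
  rw [hgeo1]
  have hT4 : 0 < 256 / T := by positivity
  calc 256 / T * ∑ k ∈ range (K + 1), (2 : ℝ) ^ k + ((K + 1 : ℕ) : ℝ) * 20 + ∑ k ∈ range (K + 1), ((2 : ℝ) ^ k)⁻¹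
      ≤ 256 / T * (2 * W) + ((K : ℝ) + 1) * 20 + 2 := by
        push_cast
        gcongr
        exact hgeo2.trans (by linarith)
    _ ≤ 512 * W / T + 40 * Real.log W + 42 := by
        have : 256 / T * (2 * W) = 512 * W / T := by ring
        rw [this]; nlinarith

/-! ### The tail set and its structure -/

/-- The `β̂` of the box with `|β̂|_∞ > T/4` (as for window elements, `exists_abs_coord_gt_of_inWindow`).
[cite: HeathBrownActa2001, §11 (11.5)] -/
def Gset (T : ℝ) : Finset (ℤ × ℤ × ℤ) := (Bbox T).filter (fun b => T / 4 < (supZ b : ℝ))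

open scoped Classical in
/-- **The tail pairs**: primitive `β̂₁, β̂₂ ∈ Gset` with `β̂₁ ∧ β̂₂ ≠ 0` and `h.c.f.(β̂₁ ∧ β̂₂) > d₀`.
[cite: HeathBrownActa2001, §12 p. 76] -/
def TLset (T d₀ : ℝ) : Finset ((ℤ × ℤ × ℤ) × (ℤ × ℤ × ℤ)) :=
  (Gset T ×ˢ Gset T).filter (fun bb => IsPrimitiveVec bb.1 ∧ IsPrimitiveVec bb.2 ∧ cross3 bb.1 bb.2 ≠ 0 ∧
    d₀ < (hcf3 (cross3 bb.1 bb.2) : ℝ))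

/-- `τ(β)` for the ideal `(β)` of the lattice vector `β̂`. [cite: HeathBrownActa2001, §12 p. 76] -/
def tauK (b : ℤ × ℤ × ℤ) : ℝ := (idealDivisorCount (Ideal.span {coordElt b}) : ℝ)

/-- `tauK ≥ 0`. [folklore] -/
theorem tauK_nonneg (b : ℤ × ℤ × ℤ) : 0 ≤ tauK b := Nat.cast_nonneg _

open scoped Classical in
/-- **The tail sum** `∑ τ(β₁)τ(β₂)τ(h.c.f.(β̂₁ ∧ β̂₂))²` over `TLset` (the weight `τ(h.c.f.)²` counts the
pairs `(D, d)` with `dD ∣ v`, `dD > d₀`). [cite: HeathBrownActa2001, §12 p. 76] -/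
def TL (T d₀ : ℝ) : ℝ :=
  ∑ bb ∈ TLset T d₀, tauK bb.1 * tauK bb.2 * ((σ 0 (hcf3 (cross3 bb.1 bb.2)) : ℝ)) ^ 2

/-- The primitive direction `α̂ = v / h.c.f.(v)` of `v = β̂₁ ∧ β̂₂`. [cite: HeathBrownActa2001, §12 p. 76] -/
def alphaOf (bb : (ℤ × ℤ × ℤ) × (ℤ × ℤ × ℤ)) : ℤ × ℤ × ℤ :=
  divVec (cross3 bb.1 bb.2) (hcf3 (cross3 bb.1 bb.2) : ℤ)

/-- `β̂₁ · (β̂₁ ∧ β̂₂) = 0` and `(β̂₁ ∧ β̂₂) · β̂₂ = 0`. [folklore] -/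
theorem dot3_cross3_self (b₁ b₂ : ℤ × ℤ × ℤ) : dot3 b₁ (cross3 b₁ b₂) = 0 ∧ dot3 (cross3 b₁ b₂) b₂ = 0 := by
  simp only [dot3, cross3]; constructor <;> ring

/-- `dot3 a (μ • v) = μ dot3 a v` and `dot3 (μ • v) a = μ dot3 v a`. [folklore] -/
theorem dot3_smul (μ : ℤ) (a v : ℤ × ℤ × ℤ) : dot3 a (μ • v) = μ * dot3 a v ∧ dot3 (μ • v) a = μ * dot3 v a := by
  simp only [dot3, Prod.smul_fst, Prod.smul_snd, smul_eq_mul]; constructor <;> ring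

open scoped Classical in
/-- **Structure of a tail pair** (`v = hα̂`, `α̂` primitive, `α̂ ⊥ β̂₁, β̂₂`, `h|α̂|_∞ = |v|_∞ ≤ 18T²`,
so `|α̂|_∞ ≤ 18T²/d₀`). [cite: HeathBrownActa2001, §12 p. 76] -/
theorem TLset_facts {T d₀ : ℝ} (hT : 0 < T) (hd : 0 < d₀) {bb : (ℤ × ℤ × ℤ) × (ℤ × ℤ × ℤ)} (hbb : bb ∈ TLset T d₀) :
    (bb.1 ∈ Gset T ∧ bb.2 ∈ Bbox T ∧ IsPrimitiveVec bb.1 ∧ IsPrimitiveVec bb.2 ∧ cross3 bb.1 bb.2 ≠ 0) ∧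
      (T / 4 < (supZ bb.1 : ℝ) ∧ (supZ bb.1 : ℝ) ≤ 3 * T ∧ (supZ bb.2 : ℝ) ≤ 3 * T) ∧
      (IsPrimitiveVec (alphaOf bb) ∧ (hcf3 (cross3 bb.1 bb.2) : ℤ) • alphaOf bb = cross3 bb.1 bb.2 ∧
        dot3 bb.1 (alphaOf bb) = 0 ∧ dot3 (alphaOf bb) bb.2 = 0) ∧
      (1 ≤ hcf3 (cross3 bb.1 bb.2) ∧ d₀ < (hcf3 (cross3 bb.1 bb.2) : ℝ) ∧
        (hcf3 (cross3 bb.1 bb.2) : ℝ) * (supZ (alphaOf bb) : ℝ) ≤ 18 * T ^ 2 ∧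
        (supZ (alphaOf bb) : ℝ) ≤ 18 * T ^ 2 / d₀ ∧ (1 : ℝ) ≤ supZ (alphaOf bb)) := by
  classical
  rw [TLset, mem_filter, mem_product] at hbb
  obtain ⟨⟨hG1, hG2⟩, hp1, hp2, hv, hD⟩ := hbb
  have hG1' := hG1
  rw [Gset, mem_filter] at hG1 hG2
  obtain ⟨hB1, hsup1⟩ := hG1
  obtain ⟨hB2, -⟩ := hG2
  have hs1 := supZ_le_of_mem_cube hB1
  have hs2 := supZ_le_of_mem_cube hB2
  have h1 : 1 ≤ hcf3 (cross3 bb.1 bb.2) := one_le_hcf3 hv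
  have hh0 : (hcf3 (cross3 bb.1 bb.2) : ℤ) ≠ 0 := by exact_mod_cast (show hcf3 (cross3 bb.1 bb.2) ≠ 0 by omega)
  have hprim : IsPrimitiveVec (alphaOf bb) := isPrimitiveVec_divVec_hcf3 hv
  have hsmul : (hcf3 (cross3 bb.1 bb.2) : ℤ) • alphaOf bb = cross3 bb.1 bb.2 := smul_divVec (hcf3_dvd _)
  have hdot1 : dot3 bb.1 (alphaOf bb) = 0 := by
    have e := (dot3_cross3_self bb.1 bb.2).1
    rw [← hsmul, (dot3_smul _ _ _).1] at e
    exact (mul_eq_zero.mp e).resolve_left hh0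
  have hdot2 : dot3 (alphaOf bb) bb.2 = 0 := by
    have e := (dot3_cross3_self bb.1 bb.2).2
    rw [← hsmul, (dot3_smul _ _ _).2] at e
    exact (mul_eq_zero.mp e).resolve_left hh0
  have hsupv : (supZ (cross3 bb.1 bb.2) : ℝ) = (hcf3 (cross3 bb.1 bb.2) : ℝ) * (supZ (alphaOf bb) : ℝ) := by
    conv_lhs => rw [← hsmul]
    rw [supZ_smul]; push_cast; rw [abs_of_nonneg (by positivity)]
  have hsup18 : (hcf3 (cross3 bb.1 bb.2) : ℝ) * (supZ (alphaOf bb) : ℝ) ≤ 18 * T ^ 2 := by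
    rw [← hsupv]
    have h := supZ_cross3_le bb.1 bb.2
    have hR : (supZ (cross3 bb.1 bb.2) : ℝ) ≤ 2 * (supZ bb.1 : ℝ) * (supZ bb.2 : ℝ) := by exact_mod_cast h
    refine hR.trans ?_
    have h0 : (0 : ℝ) ≤ supZ bb.1 := by exact_mod_cast supZ_nonneg _
    nlinarith
  have hα1 : (1 : ℝ) ≤ supZ (alphaOf bb) := by exact_mod_cast one_le_supZ hprim.ne_zero
  have hhR : (1 : ℝ) ≤ hcf3 (cross3 bb.1 bb.2) := by exact_mod_cast h1
  have hsupα : (supZ (alphaOf bb) : ℝ) ≤ 18 * T ^ 2 / d₀ := by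
    rw [le_div_iff₀ hd]
    calc (supZ (alphaOf bb) : ℝ) * d₀ ≤ (supZ (alphaOf bb) : ℝ) * (hcf3 (cross3 bb.1 bb.2) : ℝ) := by
          gcongr
      _ ≤ 18 * T ^ 2 := by rw [mul_comm]; exact hsup18
  exact ⟨⟨hG1', hB2, hp1, hp2, hv⟩, ⟨hsup1, hs1, hs2⟩, ⟨hprim, hsmul, hdot1, hdot2⟩, ⟨h1, hD, hsup18, hsupα, hα1⟩⟩

open scoped Classical in
/-- `α̂` of a tail pair lies in `perpSet β̂₁ W (cube W)`, `W = 18T²/d₀`. [cite: HeathBrownActa2001, §12 p. 76] -/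
theorem alphaOf_mem_perpSet {T d₀ : ℝ} (hT : 0 < T) (hd : 0 < d₀) {bb : (ℤ × ℤ × ℤ) × (ℤ × ℤ × ℤ)}
    (hbb : bb ∈ TLset T d₀) : alphaOf bb ∈ perpSet bb.1 (18 * T ^ 2 / d₀) (cube (18 * T ^ 2 / d₀)) := by
  classical
  obtain ⟨-, -, ⟨hprim, -, hdot1, -⟩, ⟨-, -, -, hsupα, -⟩⟩ := TLset_facts hT hd hbb
  rw [perpSet, mem_filter]
  obtain ⟨a1, a2, a3⟩ := abs_cast_le_supZ (alphaOf bb)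
  exact ⟨mem_cube_of_abs_le (a1.trans hsupα) (a2.trans hsupα) (a3.trans hsupα), hdot1, hprim.ne_zero, hsupα⟩

/-! ### The plane count for `β̂₂` -/

open scoped Classical in
/-- **`#{β̂₂ ∈ Bbox : α̂ · β̂₂ = 0} ≤ 25 (72T²/|α̂|_∞ + 1)`** for primitive `α̂ ⊥ β̂₁`, `β̂₁` primitive with
`T/4 < |β̂₁|_∞ ≤ 3T` (the plane lattice fibred along `β̂₁`). [cite: HeathBrownActa2001, Lemma 4.8] -/
theorem card_plane_Bbox_le {T : ℝ} (hT : 0 < T) {a b₁ : ℤ × ℤ × ℤ} (ha : IsPrimitiveVec a) (hb : IsPrimitiveVec b₁)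
    (hab : dot3 a b₁ = 0) (hlo : T / 4 < (supZ b₁ : ℝ)) (hhi : (supZ b₁ : ℝ) ≤ 3 * T) :
    (#((Bbox T).filter (fun b₂ => dot3 a b₂ = 0)) : ℝ) ≤ 25 * (72 * T ^ 2 / (supZ a : ℝ) + 1) := by
  classical
  have h := card_filter_dot_eq_zero_le ha hb hab (0, 0, 0) (by positivity : (0 : ℝ) ≤ 3 * T) (Bbox T)
  simp only [sub_zero] at h
  have ha1 : (1 : ℝ) ≤ supZ a := by exact_mod_cast one_le_supZ ha.ne_zero
  have hb0 : (0 : ℝ) < supZ b₁ := by linarith [show (0:ℝ) < T / 4 by positivity]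
  calc (#((Bbox T).filter (fun b₂ => dot3 a b₂ = 0)) : ℝ)
      ≤ #((Bbox T).filter (fun x => dot3 a x = 0 ∧ (|(x.1 : ℝ)| ≤ 3 * T ∧ |(x.2.1 : ℝ)| ≤ 3 * T ∧
          |(x.2.2 : ℝ)| ≤ 3 * T))) := by
        refine Nat.cast_le.mpr (card_le_card fun x hx => ?_)
        rw [mem_filter] at hx ⊢
        exact ⟨hx.1, hx.2, abs_le_of_mem_cube hx.1⟩
    _ ≤ (8 * (3 * T) * (supZ b₁ : ℝ) / (supZ a : ℝ) + 1) * (2 * (3 * T) / (supZ b₁ : ℝ) + 1) := h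
    _ ≤ (72 * T ^ 2 / (supZ a : ℝ) + 1) * 25 := by
        have f1 : 8 * (3 * T) * (supZ b₁ : ℝ) / (supZ a : ℝ) ≤ 72 * T ^ 2 / (supZ a : ℝ) := by
          rw [div_le_div_iff_of_pos_right (by linarith)]; nlinarith
        have f2 : 2 * (3 * T) / (supZ b₁ : ℝ) + 1 ≤ 25 := by
          rw [div_add_one hb0.ne', div_le_iff₀ hb0]; linarith
        exact mul_le_mul (by linarith) f2 (by positivity) (by positivity)
    _ = 25 * (72 * T ^ 2 / (supZ a : ℝ) + 1) := by ring

set_option maxHeartbeats 400000 in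
open scoped Classical in
/-- **The number of tail partners of `β̂₁`**: `#{β̂₂ : (β̂₁, β̂₂) ∈ TLset} ≤ ∑_{α̂ ∈ perpSet} 25(72T²/|α̂| + 1)`.
[cite: HeathBrownActa2001, §12 pp. 76–77] -/
theorem card_partners_le {T d₀ : ℝ} (hT : 0 < T) (hd : 0 < d₀) (b₁ : ℤ × ℤ × ℤ) :
    (#((Bbox T).filter (fun b₂ => (b₁, b₂) ∈ TLset T d₀)) : ℝ) ≤
      ∑ a ∈ perpSet b₁ (18 * T ^ 2 / d₀) (cube (18 * T ^ 2 / d₀)), 25 * (72 * T ^ 2 / (supZ a : ℝ) + 1) := by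
  classical
  set F := (Bbox T).filter (fun b₂ => (b₁, b₂) ∈ TLset T d₀) with hF
  set P := perpSet b₁ (18 * T ^ 2 / d₀) (cube (18 * T ^ 2 / d₀)) with hP
  have hmaps : ∀ b₂ ∈ F, alphaOf (b₁, b₂) ∈ P := by
    intro b₂ hb₂
    rw [hF, mem_filter] at hb₂
    exact alphaOf_mem_perpSet hT hd hb₂.2
  rw [card_eq_sum_card_fiberwise hmaps]
  push_cast
  refine sum_le_sum fun a ha => ?_
  -- the fibre lies in the plane `a^⊥`; need the facts for some element to get the `β̂₁` bounds
  by_cases hempty : (F.filter fun b₂ => alphaOf (b₁, b₂) = a) = ∅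
  · rw [hempty, card_empty, Nat.cast_zero]
    have : (1 : ℝ) ≤ supZ a := by
      rw [hP, perpSet, mem_filter] at ha
      exact_mod_cast one_le_supZ ha.2.2.1
    positivity
  · obtain ⟨b₀, hb₀⟩ := nonempty_iff_ne_empty.mpr hempty
    rw [mem_filter, hF, mem_filter] at hb₀
    obtain ⟨⟨-, hTL⟩, hαa⟩ := hb₀
    obtain ⟨⟨-, -, hp1, -, -⟩, ⟨hlo, hhi, -⟩, ⟨hprim, -, hdot1, -⟩, -⟩ := TLset_facts hT hd hTL
    rw [hαa] at hprim hdot1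
    have hdot1' : dot3 a b₁ = 0 := by rw [← hdot1]; simp only [dot3]; ring
    refine le_trans ?_ (card_plane_Bbox_le hT hprim hp1 hdot1' hlo hhi)
    refine Nat.cast_le.mpr (card_le_card fun b₂ hb₂ => ?_)
    rw [mem_filter, hF, mem_filter] at hb₂
    obtain ⟨⟨hB, hTL2⟩, hα2⟩ := hb₂
    rw [mem_filter]
    obtain ⟨-, -, ⟨-, -, -, hdot2⟩, -⟩ := TLset_facts hT hd hTL2
    rw [hα2] at hdot2
    exact ⟨hB, hdot2⟩

/-! ### The divisor-power sum along a fibre -/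

open scoped Classical in
/-- **Along the fibre `α̂(β̂₁, β̂₂) = α̂`** the h.c.f. `h` (with `v = hα̂`) determines `β̂₂` up to `≤ 49`
translates by `β̂₁`, and `1 ≤ h ≤ 18T²/|α̂|_∞`; hence
`∑_{β̂₂ in the fibre} σ₀(h)⁶ ≤ 49 ∑_{n ≤ 18T²/|α̂|_∞} σ₀(n)⁶`. [cite: HeathBrownActa2001, §12 pp. 76–77] -/
theorem sum_fibre_sigma_pow_le {T d₀ : ℝ} (hT : 0 < T) (hd : 0 < d₀) (b₁ a : ℤ × ℤ × ℤ) :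
    ∑ b₂ ∈ (Bbox T).filter (fun b₂ => (b₁, b₂) ∈ TLset T d₀ ∧ alphaOf (b₁, b₂) = a),
        ((σ 0 (hcf3 (cross3 b₁ b₂)) : ℝ)) ^ 6 ≤
      49 * ∑ n ∈ Icc 1 ⌊18 * T ^ 2 / (supZ a : ℝ)⌋₊, ((σ 0 n : ℝ)) ^ 6 := by
  classical
  set F := (Bbox T).filter (fun b₂ => (b₁, b₂) ∈ TLset T d₀ ∧ alphaOf (b₁, b₂) = a) with hF
  set hf : ℤ × ℤ × ℤ → ℕ := fun b₂ => hcf3 (cross3 b₁ b₂) with hhf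
  have hmaps : ∀ b₂ ∈ F, hf b₂ ∈ Icc 1 ⌊18 * T ^ 2 / (supZ a : ℝ)⌋₊ := by
    intro b₂ hb₂
    rw [hF, mem_filter] at hb₂
    obtain ⟨-, hTL, hαa⟩ := hb₂
    obtain ⟨-, -, -, ⟨h1, -, h18, -, hα1⟩⟩ := TLset_facts hT hd hTL
    rw [hαa] at h18 hα1
    rw [mem_Icc]
    refine ⟨h1, Nat.le_floor ?_⟩
    rw [le_div_iff₀ (by linarith)]
    exact h18
  -- fibres of `hf` on `F` have at most 49 elements
  have hfib : ∀ n, (#(F.filter fun b₂ => hf b₂ = n) : ℝ) ≤ 49 := by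
    intro n
    by_cases hempty : (F.filter fun b₂ => hf b₂ = n) = ∅
    · rw [hempty, card_empty]; norm_num
    obtain ⟨b₀, hb₀⟩ := nonempty_iff_ne_empty.mpr hempty
    rw [mem_filter, hF, mem_filter] at hb₀
    obtain ⟨⟨hB0, hTL0, hα0⟩, hn0⟩ := hb₀
    obtain ⟨⟨-, -, hp1, -, -⟩, ⟨hlo, -, hs0⟩, ⟨-, hsm0, -, -⟩, -⟩ := TLset_facts hT hd hTL0
    -- every element of the fibre is `b₀ + k • b₁` with `|k| ≤ 24`
    have hsub : (F.filter fun b₂ => hf b₂ = n) ⊆ (Icc (-24 : ℤ) 24).image (fun k => b₀ + k • b₁) := by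
      intro b₂ hb₂
      rw [mem_filter, hF, mem_filter] at hb₂
      obtain ⟨⟨hB2, hTL2, hα2⟩, hn2⟩ := hb₂
      obtain ⟨-, ⟨-, -, hs2⟩, ⟨-, hsm2, -, -⟩, -⟩ := TLset_facts hT hd hTL2
      -- same `v`
      have hv : cross3 b₁ b₂ = cross3 b₁ b₀ := by
        have e2 := hsm2; have e0 := hsm0
        simp only at e2 e0
        rw [hα2] at e2; rw [hα0] at e0
        have : hf b₂ = hf b₀ := hn2.trans hn0.symm
        simp only [hhf] at this
        rw [← e2, ← e0, this]
      have hc : cross3 b₁ (b₂ - b₀) = 0 := by rw [cross3_sub_right, hv, sub_self]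
      obtain ⟨k, hk⟩ := exists_eq_smul_of_cross3_eq_zero hp1 hc
      rw [mem_image]
      refine ⟨k, ?_, by rw [← hk]; abel⟩
      -- `|k| ≤ 24`
      have hks : supZ (b₂ - b₀) = |k| * supZ b₁ := by rw [hk, supZ_smul]
      have hdiff : (supZ (b₂ - b₀) : ℝ) ≤ 6 * T := by
        have h3 := abs_cast_le_supZ b₂
        have h4 := abs_cast_le_supZ b₀
        have hR : ((supZ (b₂ - b₀) : ℤ) : ℝ) = max |((b₂ - b₀).1 : ℝ)| (max |((b₂ - b₀).2.1 : ℝ)| |((b₂ - b₀).2.2 : ℝ)|) := by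
          simp only [supZ]; push_cast; rfl
        rw [hR]
        simp only [Prod.fst_sub, Prod.snd_sub, Int.cast_sub]
        refine max_le ?_ (max_le ?_ ?_)
        · calc |(b₂.1 : ℝ) - b₀.1| ≤ |(b₂.1 : ℝ)| + |(b₀.1 : ℝ)| := abs_sub _ _
            _ ≤ 6 * T := by linarith [h3.1.trans hs2, h4.1.trans hs0]
        · calc |(b₂.2.1 : ℝ) - b₀.2.1| ≤ |(b₂.2.1 : ℝ)| + |(b₀.2.1 : ℝ)| := abs_sub _ _
            _ ≤ 6 * T := by linarith [h3.2.1.trans hs2, h4.2.1.trans hs0]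
        · calc |(b₂.2.2 : ℝ) - b₀.2.2| ≤ |(b₂.2.2 : ℝ)| + |(b₀.2.2 : ℝ)| := abs_sub _ _
            _ ≤ 6 * T := by linarith [h3.2.2.trans hs2, h4.2.2.trans hs0]
      have hkR : (|k| : ℝ) * (supZ b₁ : ℝ) ≤ 6 * T := by
        have : ((supZ (b₂ - b₀) : ℤ) : ℝ) = (|k| : ℝ) * (supZ b₁ : ℝ) := by rw [hks]; push_cast; rfl
        rw [← this]; exact hdiff
      have hk24 : |(k : ℝ)| < 25 := by
        by_contra hcon
        push Not at hcon
        have h0 : (0 : ℝ) ≤ supZ b₁ := by exact_mod_cast supZ_nonneg _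
        have := mul_le_mul_of_nonneg_right hcon h0
        linarith
      have hk24' : |k| ≤ 24 := by
        have h := hk24
        rw [← Int.cast_abs] at h
        have : |k| < 25 := by exact_mod_cast h
        omega
      rw [mem_Icc]; exact abs_le.mp hk24'
    calc (#(F.filter fun b₂ => hf b₂ = n) : ℝ) ≤ #((Icc (-24 : ℤ) 24).image (fun k => b₀ + k • b₁)) := by
          exact_mod_cast card_le_card hsub
      _ ≤ #(Icc (-24 : ℤ) 24) := by exact_mod_cast card_image_le
      _ = 49 := by simp
  rw [← sum_fiberwise_of_maps_to hmaps, mul_sum]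
  refine sum_le_sum fun n _ => ?_
  rw [sum_filter]
  calc ∑ b₂ ∈ F, (if hf b₂ = n then ((σ 0 (hcf3 (cross3 b₁ b₂)) : ℝ)) ^ 6 else 0)
      = ∑ b₂ ∈ F, (if hf b₂ = n then ((σ 0 n : ℝ)) ^ 6 else 0) := by
        refine sum_congr rfl fun b₂ _ => ?_
        by_cases h : hf b₂ = n
        · rw [if_pos h, if_pos h, ← h]
        · rw [if_neg h, if_neg h]
    _ = #(F.filter fun b₂ => hf b₂ = n) * ((σ 0 n : ℝ)) ^ 6 := by rw [← sum_filter, sum_const, nsmul_eq_mul]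
    _ ≤ 49 * ((σ 0 n : ℝ)) ^ 6 := by gcongr; exact hfib n

/-! ### Assembly of the tail bound -/

open scoped Classical in
/-- Re-indexing a nonnegative sum over `TLset` by `β̂₁ ∈ Gset` and its partners `β̂₂ ∈ Bbox`. [folklore] -/
theorem sum_TLset_le_sum_sum {T d₀ : ℝ} (hT : 0 < T) (hd : 0 < d₀) (G : (ℤ × ℤ × ℤ) × (ℤ × ℤ × ℤ) → ℝ)
    (hG : ∀ bb, 0 ≤ G bb) :
    ∑ bb ∈ TLset T d₀, G bb ≤
      ∑ b₁ ∈ Gset T, ∑ b₂ ∈ (Bbox T).filter (fun b₂ => (b₁, b₂) ∈ TLset T d₀), G (b₁, b₂) := by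
  classical
  have hsub : TLset T d₀ ⊆ (Gset T ×ˢ Bbox T).filter (fun bb => bb ∈ TLset T d₀) := by
    intro bb hbb
    rw [mem_filter, mem_product]
    obtain ⟨⟨hG1, hB2, -⟩, -⟩ := TLset_facts hT hd hbb
    exact ⟨⟨hG1, hB2⟩, hbb⟩
  calc ∑ bb ∈ TLset T d₀, G bb ≤ ∑ bb ∈ (Gset T ×ˢ Bbox T).filter (fun bb => bb ∈ TLset T d₀), G bb :=
        sum_le_sum_of_subset_of_nonneg hsub (fun _ _ _ => hG _)
    _ = ∑ b₁ ∈ Gset T, ∑ b₂ ∈ (Bbox T).filter (fun b₂ => (b₁, b₂) ∈ TLset T d₀), G (b₁, b₂) := by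
        rw [sum_filter, sum_product]
        refine sum_congr rfl fun b₁ _ => ?_
        rw [sum_filter]

open scoped Classical in
/-- `TLset` is symmetric: `∑_{TLset} g(β̂₂) = ∑_{TLset} g(β̂₁)`. [folklore] -/
theorem sum_TLset_snd_eq {T d₀ : ℝ} (g : ℤ × ℤ × ℤ → ℝ) :
    ∑ bb ∈ TLset T d₀, g bb.2 = ∑ bb ∈ TLset T d₀, g bb.1 := by
  classical
  refine sum_nbij' (fun bb => bb.swap) (fun bb => bb.swap) (fun bb hbb => ?_) (fun bb hbb => ?_)
    (fun bb _ => Prod.swap_swap bb) (fun bb _ => Prod.swap_swap bb) (fun bb _ => rfl)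
  all_goals
    rw [TLset, mem_filter, mem_product] at hbb ⊢
    obtain ⟨⟨h1, h2⟩, hp1, hp2, hv, hD⟩ := hbb
    refine ⟨⟨h2, h1⟩, hp2, hp1, ?_, ?_⟩
    · simp only [Prod.fst_swap, Prod.snd_swap]; rw [cross3_swap, neg_ne_zero]; exact hv
    · simp only [Prod.fst_swap, Prod.snd_swap]; rw [cross3_swap, hcf3_neg]; exact hD

/-- If `18T² < d₀` the tail set is empty. [folklore] -/
theorem TLset_eq_empty {T d₀ : ℝ} (hT : 0 < T) (hd : 0 < d₀) (hW : 18 * T ^ 2 / d₀ < 1) :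
    TLset T d₀ = ∅ := by
  classical
  rw [eq_empty_iff_forall_notMem]
  intro bb hbb
  obtain ⟨-, -, -, ⟨-, -, -, hsupα, hα1⟩⟩ := TLset_facts hT hd hbb
  linarith

open scoped Classical in
/-- **The partner count is uniform**: `#{β̂₂ : (β̂₁,β̂₂) ∈ TLset} ≤ B₁ :=
1800T²(512W/T + 40 log W + 42) + 25(64W²/T + 10W + 1)`, `W = 18T²/d₀ ≥ 1`. [cite: HeathBrownActa2001, §12 p. 77] -/
theorem card_partners_le' {T d₀ : ℝ} (hT : 0 < T) (hd : 0 < d₀) (hW : 1 ≤ 18 * T ^ 2 / d₀) (b₁ : ℤ × ℤ × ℤ) :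
    (#((Bbox T).filter (fun b₂ => (b₁, b₂) ∈ TLset T d₀)) : ℝ) ≤
      1800 * T ^ 2 * (512 * (18 * T ^ 2 / d₀) / T + 40 * Real.log (18 * T ^ 2 / d₀) + 42) +
        25 * (64 * (18 * T ^ 2 / d₀) ^ 2 / T + 10 * (18 * T ^ 2 / d₀) + 1) := by
  classical
  set W : ℝ := 18 * T ^ 2 / d₀ with hWdef
  have hlogW : 0 ≤ Real.log W := Real.log_nonneg hW
  by_cases hempty : (Bbox T).filter (fun b₂ => (b₁, b₂) ∈ TLset T d₀) = ∅
  · rw [hempty, card_empty, Nat.cast_zero]; positivity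
  obtain ⟨b₀, hb₀⟩ := nonempty_iff_ne_empty.mpr hempty
  rw [mem_filter] at hb₀
  obtain ⟨⟨-, -, hp1, -, -⟩, ⟨hlo, -, -⟩, -, -⟩ := TLset_facts hT hd hb₀.2
  refine (card_partners_le hT hd b₁).trans ?_
  rw [← hWdef]
  have e1 : ∑ a ∈ perpSet b₁ W (cube W), (25 : ℝ) * (72 * T ^ 2 / (supZ a : ℝ) + 1) =
      1800 * T ^ 2 * ∑ a ∈ perpSet b₁ W (cube W), ((supZ a : ℝ))⁻¹ + 25 * #(perpSet b₁ W (cube W)) := by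
    simp_rw [mul_add, mul_one, div_eq_mul_inv]
    rw [sum_add_distrib, sum_const, nsmul_eq_mul, ← mul_sum, ← mul_sum]; ring
  rw [e1]
  have h1 := sum_inv_supZ_perp_le hT hp1 hlo hW (cube W)
  have h2 := card_perpSet_le hp1 (by linarith : (0 : ℝ) ≤ W) (cube W)
  have h2' : (#(perpSet b₁ W (cube W)) : ℝ) ≤ 64 * W ^ 2 / T + 10 * W + 1 := by
    refine h2.trans ?_
    have hsb : T / 4 < (supZ b₁ : ℝ) := hlo
    have : 16 * W ^ 2 / (supZ b₁ : ℝ) ≤ 64 * W ^ 2 / T := by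
      rw [div_le_div_iff₀ (by linarith) hT]; nlinarith [sq_nonneg W]
    linarith
  have hT2 : (0 : ℝ) ≤ 1800 * T ^ 2 := by positivity
  have := mul_le_mul_of_nonneg_left h1 hT2
  linarith

open scoped Classical in
/-- **The `τ(β₁)³` part**: `∑_{TLset} τ(β₁)³ ≤ (∑_{β̂ ∈ cube(3T)} τ(β)³) · B₁`. [cite: HeathBrownActa2001, §12 pp. 76–77] -/
theorem sum_TLset_tauK_cube_le {T d₀ : ℝ} (hT : 0 < T) (hd : 0 < d₀) (hW : 1 ≤ 18 * T ^ 2 / d₀) :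
    ∑ bb ∈ TLset T d₀, tauK bb.1 ^ 3 ≤
      (∑ b ∈ cube (3 * T), tauK b ^ 3) *
        (1800 * T ^ 2 * (512 * (18 * T ^ 2 / d₀) / T + 40 * Real.log (18 * T ^ 2 / d₀) + 42) +
          25 * (64 * (18 * T ^ 2 / d₀) ^ 2 / T + 10 * (18 * T ^ 2 / d₀) + 1)) := by
  classical
  set B₁ : ℝ := 1800 * T ^ 2 * (512 * (18 * T ^ 2 / d₀) / T + 40 * Real.log (18 * T ^ 2 / d₀) + 42) +
    25 * (64 * (18 * T ^ 2 / d₀) ^ 2 / T + 10 * (18 * T ^ 2 / d₀) + 1) with hB₁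
  have hlogW : 0 ≤ Real.log (18 * T ^ 2 / d₀) := Real.log_nonneg hW
  have hB₁0 : 0 ≤ B₁ := by positivity
  have h3 : ∀ b, 0 ≤ tauK b ^ 3 := fun b => by have := tauK_nonneg b; positivity
  refine (sum_TLset_le_sum_sum hT hd (fun bb => tauK bb.1 ^ 3) (fun bb => h3 bb.1)).trans ?_
  calc ∑ b₁ ∈ Gset T, ∑ _b₂ ∈ (Bbox T).filter (fun b₂ => (b₁, b₂) ∈ TLset T d₀), tauK b₁ ^ 3
      = ∑ b₁ ∈ Gset T, tauK b₁ ^ 3 * (#((Bbox T).filter (fun b₂ => (b₁, b₂) ∈ TLset T d₀)) : ℝ) := by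
        refine sum_congr rfl fun b₁ _ => ?_
        rw [sum_const, nsmul_eq_mul, mul_comm]
    _ ≤ ∑ b₁ ∈ Gset T, tauK b₁ ^ 3 * B₁ := by
        refine sum_le_sum fun b₁ _ => ?_
        exact mul_le_mul_of_nonneg_left (card_partners_le' hT hd hW b₁) (h3 b₁)
    _ = (∑ b₁ ∈ Gset T, tauK b₁ ^ 3) * B₁ := by rw [sum_mul]
    _ ≤ (∑ b ∈ cube (3 * T), tauK b ^ 3) * B₁ := by
        refine mul_le_mul_of_nonneg_right ?_ hB₁0
        refine sum_le_sum_of_subset_of_nonneg (fun b hb => ?_) (fun b _ _ => h3 b)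
        rw [Gset, mem_filter] at hb; exact hb.1

open scoped Classical in
/-- The fibre bound in closed form: for `α̂ ∈ perpSet`, with `∑_{n ≤ x} σ₀(n)⁶ ≤ C₆ x (log x)^{128}` (`x ≥ 2`),
`∑_{fibre} σ₀(h)⁶ ≤ 49 C₆ (log(18T² + 2))^{128} (18T²/|α̂|_∞ + 2)`. [cite: HeathBrownActa2001, §12 p. 77] -/
theorem sum_fibre_sigma_pow_le' {T d₀ : ℝ} (hT : 0 < T) (hd : 0 < d₀) {C₆ : ℝ} (hC₆ : 0 < C₆)
    (hσ : ∀ x : ℝ, 2 ≤ x → ∑ n ∈ Icc 1 ⌊x⌋₊, ((σ 0 n : ℝ)) ^ 6 ≤ C₆ * x * Real.log x ^ 128)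
    (b₁ : ℤ × ℤ × ℤ) {a : ℤ × ℤ × ℤ} (ha : a ≠ 0) :
    ∑ b₂ ∈ (Bbox T).filter (fun b₂ => (b₁, b₂) ∈ TLset T d₀ ∧ alphaOf (b₁, b₂) = a),
        ((σ 0 (hcf3 (cross3 b₁ b₂)) : ℝ)) ^ 6 ≤
      49 * C₆ * Real.log (18 * T ^ 2 + 2) ^ 128 * (18 * T ^ 2 * ((supZ a : ℝ))⁻¹ + 2) := by
  have ha1 : (1 : ℝ) ≤ supZ a := by exact_mod_cast one_le_supZ ha
  refine (sum_fibre_sigma_pow_le hT hd b₁ a).trans ?_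
  have hq0 : 0 ≤ 18 * T ^ 2 / (supZ a : ℝ) := by positivity
  have hx2 : (2 : ℝ) ≤ 18 * T ^ 2 / (supZ a : ℝ) + 2 := by linarith
  have hsub : Icc 1 ⌊18 * T ^ 2 / (supZ a : ℝ)⌋₊ ⊆ Icc 1 ⌊18 * T ^ 2 / (supZ a : ℝ) + 2⌋₊ :=
    Icc_subset_Icc le_rfl (Nat.floor_le_floor (by linarith))
  have hxle : 18 * T ^ 2 / (supZ a : ℝ) + 2 ≤ 18 * T ^ 2 + 2 := by
    have : 18 * T ^ 2 / (supZ a : ℝ) ≤ 18 * T ^ 2 := div_le_self (by positivity) ha1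
    linarith
  have hlogx : Real.log (18 * T ^ 2 / (supZ a : ℝ) + 2) ≤ Real.log (18 * T ^ 2 + 2) :=
    Real.log_le_log (by linarith) hxle
  have hlogx0 : 0 ≤ Real.log (18 * T ^ 2 / (supZ a : ℝ) + 2) := Real.log_nonneg (by linarith)
  have hmain := hσ _ hx2
  calc 49 * ∑ n ∈ Icc 1 ⌊18 * T ^ 2 / (supZ a : ℝ)⌋₊, ((σ 0 n : ℝ)) ^ 6
      ≤ 49 * ∑ n ∈ Icc 1 ⌊18 * T ^ 2 / (supZ a : ℝ) + 2⌋₊, ((σ 0 n : ℝ)) ^ 6 := by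
        gcongr
    _ ≤ 49 * (C₆ * (18 * T ^ 2 / (supZ a : ℝ) + 2) * Real.log (18 * T ^ 2 / (supZ a : ℝ) + 2) ^ 128) := by
        gcongr
    _ ≤ 49 * (C₆ * (18 * T ^ 2 / (supZ a : ℝ) + 2) * Real.log (18 * T ^ 2 + 2) ^ 128) := by gcongr
    _ = 49 * C₆ * Real.log (18 * T ^ 2 + 2) ^ 128 * (18 * T ^ 2 * ((supZ a : ℝ))⁻¹ + 2) := by
        rw [div_eq_mul_inv]; ring

set_option maxHeartbeats 800000 in
open scoped Classical in
/-- **The `σ₀(h)⁶` part, per `β̂₁`**: `∑_{partners β̂₂} σ₀(h)⁶ ≤ 49 C₆ (log(18T²+2))^{128} (18T² H + 2P)`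
(`H ≤ 512W/T + 40 log W + 42`, `P ≤ 64W²/T + 10W + 1`). [cite: HeathBrownActa2001, §12 p. 77] -/
theorem sum_partners_sigma_le {T d₀ : ℝ} (hT : 0 < T) (hd : 0 < d₀) (hW : 1 ≤ 18 * T ^ 2 / d₀) {C₆ : ℝ}
    (hC₆ : 0 < C₆) (hσ : ∀ x : ℝ, 2 ≤ x → ∑ n ∈ Icc 1 ⌊x⌋₊, ((σ 0 n : ℝ)) ^ 6 ≤ C₆ * x * Real.log x ^ 128)
    (b₁ : ℤ × ℤ × ℤ) :
    ∑ b₂ ∈ (Bbox T).filter (fun b₂ => (b₁, b₂) ∈ TLset T d₀), ((σ 0 (hcf3 (cross3 b₁ b₂)) : ℝ)) ^ 6 ≤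
      49 * C₆ * Real.log (18 * T ^ 2 + 2) ^ 128 *
        (18 * T ^ 2 * (512 * (18 * T ^ 2 / d₀) / T + 40 * Real.log (18 * T ^ 2 / d₀) + 42) +
          2 * (64 * (18 * T ^ 2 / d₀) ^ 2 / T + 10 * (18 * T ^ 2 / d₀) + 1)) := by
  classical
  set W : ℝ := 18 * T ^ 2 / d₀ with hWdef
  set K : ℝ := 49 * C₆ * Real.log (18 * T ^ 2 + 2) ^ 128 with hK
  have hLg0 : 0 ≤ Real.log (18 * T ^ 2 + 2) := Real.log_nonneg (by nlinarith)
  have hK0 : 0 ≤ K := by positivity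
  have hlogW : 0 ≤ Real.log W := Real.log_nonneg hW
  set F := (Bbox T).filter (fun b₂ => (b₁, b₂) ∈ TLset T d₀) with hF
  by_cases hempty : F = ∅
  · rw [hempty, sum_empty]; positivity
  obtain ⟨b₀, hb₀⟩ := nonempty_iff_ne_empty.mpr hempty
  rw [hF, mem_filter] at hb₀
  obtain ⟨⟨-, -, hp1, -, -⟩, ⟨hlo, -, -⟩, -, -⟩ := TLset_facts hT hd hb₀.2
  set P := perpSet b₁ W (cube W) with hP
  have hmaps : ∀ b₂ ∈ F, alphaOf (b₁, b₂) ∈ P := by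
    intro b₂ hb₂; rw [hF, mem_filter] at hb₂; exact alphaOf_mem_perpSet hT hd hb₂.2
  rw [← sum_fiberwise_of_maps_to hmaps]
  have hfib : ∀ a ∈ P, ∑ b₂ ∈ F.filter (fun b₂ => alphaOf (b₁, b₂) = a), ((σ 0 (hcf3 (cross3 b₁ b₂)) : ℝ)) ^ 6 ≤
      K * (18 * T ^ 2 * ((supZ a : ℝ))⁻¹ + 2) := by
    intro a ha
    have ha0 : a ≠ 0 := by rw [hP, perpSet, mem_filter] at ha; exact ha.2.2.1
    have hFa : F.filter (fun b₂ => alphaOf (b₁, b₂) = a) =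
        (Bbox T).filter (fun b₂ => (b₁, b₂) ∈ TLset T d₀ ∧ alphaOf (b₁, b₂) = a) := by
      rw [hF, filter_filter]
    rw [hFa]
    exact sum_fibre_sigma_pow_le' hT hd hC₆ hσ b₁ ha0
  refine (sum_le_sum hfib).trans ?_
  rw [← mul_sum, sum_add_distrib, ← mul_sum, sum_const, nsmul_eq_mul]
  refine mul_le_mul_of_nonneg_left ?_ hK0
  have h1 := sum_inv_supZ_perp_le hT hp1 hlo hW (cube W)
  have h2 := card_perpSet_le hp1 (by linarith : (0 : ℝ) ≤ W) (cube W)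
  have h2' : (#(perpSet b₁ W (cube W)) : ℝ) ≤ 64 * W ^ 2 / T + 10 * W + 1 := by
    refine h2.trans ?_
    have hsb : T / 4 < (supZ b₁ : ℝ) := hlo
    have : 16 * W ^ 2 / (supZ b₁ : ℝ) ≤ 64 * W ^ 2 / T := by
      rw [div_le_div_iff₀ (by linarith) hT]; nlinarith [sq_nonneg W]
    linarith
  rw [← hP] at h1 h2'
  have hT2 : (0 : ℝ) ≤ 18 * T ^ 2 := by positivity
  have := mul_le_mul_of_nonneg_left h1 hT2
  linarith

open scoped Classical in
/-- **The `σ₀(h)⁶` part**: `∑_{TLset} σ₀(h)⁶ ≤ #cube(3T) · 49 C₆ (log(18T²+2))^{128} (18T² H + 2P)`.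
[cite: HeathBrownActa2001, §12 pp. 76–77] -/
theorem sum_TLset_sigma_le {T d₀ : ℝ} (hT : 0 < T) (hd : 0 < d₀) (hW : 1 ≤ 18 * T ^ 2 / d₀) {C₆ : ℝ} (hC₆ : 0 < C₆)
    (hσ : ∀ x : ℝ, 2 ≤ x → ∑ n ∈ Icc 1 ⌊x⌋₊, ((σ 0 n : ℝ)) ^ 6 ≤ C₆ * x * Real.log x ^ 128) :
    ∑ bb ∈ TLset T d₀, ((σ 0 (hcf3 (cross3 bb.1 bb.2)) : ℝ)) ^ 6 ≤
      #(cube (3 * T)) * (49 * C₆ * Real.log (18 * T ^ 2 + 2) ^ 128 *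
        (18 * T ^ 2 * (512 * (18 * T ^ 2 / d₀) / T + 40 * Real.log (18 * T ^ 2 / d₀) + 42) +
          2 * (64 * (18 * T ^ 2 / d₀) ^ 2 / T + 10 * (18 * T ^ 2 / d₀) + 1))) := by
  classical
  refine (sum_TLset_le_sum_sum hT hd (fun bb => ((σ 0 (hcf3 (cross3 bb.1 bb.2)) : ℝ)) ^ 6)
    (fun _ => by positivity)).trans ?_
  refine (sum_le_sum fun b₁ _ => sum_partners_sigma_le hT hd hW hC₆ hσ b₁).trans ?_
  rw [sum_const, nsmul_eq_mul]
  have hlogW : 0 ≤ Real.log (18 * T ^ 2 / d₀) := Real.log_nonneg hW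
  have hLg0 : 0 ≤ Real.log (18 * T ^ 2 + 2) := Real.log_nonneg (by nlinarith)
  gcongr
  intro b hb
  rw [Gset, mem_filter] at hb; exact hb.1

/-! ### Elementary bounds for `T ≥ 2`, `d₀ ≥ 1` -/

/-- `log(18T² + 2) ≤ 7 log T`, `log(18T²/d₀) ≤ 7 log T`, `log(6T + 2) ≤ 4 log T`, `1 ≤ 2 log T` (`T ≥ 2`, `d₀ ≥ 1`).
[folklore] -/
theorem tail_log_bounds {T d₀ : ℝ} (hT : 2 ≤ T) (hd : 1 ≤ d₀) :
    Real.log (18 * T ^ 2 + 2) ≤ 7 * Real.log T ∧ Real.log (18 * T ^ 2 / d₀) ≤ 7 * Real.log T ∧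
      Real.log (2 * (3 * T) + 2) ≤ 4 * Real.log T ∧ 1 ≤ 2 * Real.log T := by
  have hT0 : 0 < T := by linarith
  have hl2 : (1 : ℝ) ≤ 2 * Real.log T := by
    have h := Real.log_two_gt_d9
    have : Real.log 2 ≤ Real.log T := Real.log_le_log (by norm_num) hT
    linarith
  have hT5 : (32 : ℝ) ≤ T ^ 5 := by nlinarith [pow_le_pow_left₀ (by norm_num : (0:ℝ) ≤ 2) hT 5]
  have h7 : 18 * T ^ 2 + 2 ≤ T ^ 7 := by nlinarith
  have hlog7 : Real.log (T ^ 7) = 7 * Real.log T := by rw [Real.log_pow]; push_cast; ring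
  have hlog4 : Real.log (T ^ 4) = 4 * Real.log T := by rw [Real.log_pow]; push_cast; ring
  refine ⟨?_, ?_, ?_, hl2⟩
  · rw [← hlog7]; exact Real.log_le_log (by positivity) h7
  · rw [← hlog7]
    refine Real.log_le_log (by positivity) (le_trans ?_ h7)
    calc 18 * T ^ 2 / d₀ ≤ 18 * T ^ 2 := div_le_self (by positivity) hd
      _ ≤ 18 * T ^ 2 + 2 := by linarith
  · rw [← hlog4]
    refine Real.log_le_log (by positivity) ?_
    have hT3 : (8 : ℝ) ≤ T ^ 3 := by nlinarith [pow_le_pow_left₀ (by norm_num : (0:ℝ) ≤ 2) hT 3]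
    nlinarith

/-- `(log T)^a ≤ 2^{b−a} (log T)^b` for `a ≤ b`, `T ≥ 2`. [folklore] -/
theorem log_pow_le_log_pow {T : ℝ} (hT : 2 ≤ T) {a b : ℕ} (hab : a ≤ b) :
    Real.log T ^ a ≤ 2 ^ (b - a) * Real.log T ^ b := by
  have hl := (tail_log_bounds hT le_rfl).2.2.2
  have hl0 : 0 ≤ Real.log T := by linarith
  obtain ⟨k, rfl⟩ := Nat.exists_eq_add_of_le hab
  rw [Nat.add_sub_cancel_left, pow_add]
  have : (1 : ℝ) ≤ 2 ^ k * Real.log T ^ k := by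
    rw [← mul_pow]; exact one_le_pow₀ hl
  nlinarith [pow_nonneg hl0 a]

/-- The two brackets: `T²(512W/T + 40 log W + 42) ≤ 2·10⁴ (T³/d₀ + T²) log T` and
`64W²/T + 10W + 1 ≤ 5·10⁴ (T³/d₀ + T²) log T` (`W = 18T²/d₀`, `T ≥ 2`, `d₀ ≥ 1`). [folklore] -/
theorem bracket_bounds {T d₀ : ℝ} (hT : 2 ≤ T) (hd : 1 ≤ d₀) :
    T ^ 2 * (512 * (18 * T ^ 2 / d₀) / T + 40 * Real.log (18 * T ^ 2 / d₀) + 42) ≤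
        20000 * (T ^ 3 / d₀ + T ^ 2) * Real.log T ∧
      64 * (18 * T ^ 2 / d₀) ^ 2 / T + 10 * (18 * T ^ 2 / d₀) + 1 ≤ 50000 * (T ^ 3 / d₀ + T ^ 2) * Real.log T := by
  obtain ⟨-, hlW, -, hl2⟩ := tail_log_bounds hT hd
  have hT0 : 0 < T := by linarith
  have hd0 : 0 < d₀ := by linarith
  have hl0 : 0 ≤ Real.log T := by linarith
  have hQ0 : 0 ≤ T ^ 3 / d₀ := by positivity
  have e1 : T ^ 2 * (512 * (18 * T ^ 2 / d₀) / T) = 9216 * (T ^ 3 / d₀) := by field_simp; ring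
  have e2 : 64 * (18 * T ^ 2 / d₀) ^ 2 / T = 20736 * (T ^ 3 / d₀) / d₀ := by field_simp; ring
  have hW1 : 18 * T ^ 2 / d₀ ≤ 18 * T ^ 2 := div_le_self (by positivity) hd
  have hQd : 20736 * (T ^ 3 / d₀) / d₀ ≤ 20736 * (T ^ 3 / d₀) := div_le_self (by positivity) hd
  have hT2 : (4 : ℝ) ≤ T ^ 2 := by nlinarith
  constructor
  · rw [mul_add, mul_add, e1]
    have h40 : T ^ 2 * (40 * Real.log (18 * T ^ 2 / d₀)) ≤ 280 * T ^ 2 * Real.log T := by nlinarith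
    nlinarith [mul_nonneg hQ0 hl0, mul_nonneg (by positivity : (0:ℝ) ≤ T ^ 2) hl0]
  · rw [e2]
    nlinarith [mul_nonneg hQ0 hl0, mul_nonneg (by positivity : (0:ℝ) ≤ T ^ 2) hl0]

open scoped Classical in
/-- **The tail estimate** (Heath-Brown: "a bound `O(VXY⁻¹⁵(log X)^c)`" for the range `dD > d₀`; here in the
global form `∑ τ(β₁)τ(β₂)τ(h)² ≤ C (T⁶/d₀ + T⁵)(log T)^e` over all pairs of the box with `h > d₀`).
[cite: HeathBrownActa2001, §12 p. 77] -/
theorem exists_TL_bound : ∃ C : ℝ, ∃ e : ℕ, 0 < C ∧ ∀ T d₀ : ℝ, 2 ≤ T → 1 ≤ d₀ →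
    TL T d₀ ≤ C * (T ^ 6 / d₀ + T ^ 5) * Real.log T ^ e := by
  classical
  obtain ⟨C₃, e₃, hC₃, h₃⟩ := exists_sum_box_idealDivisorCount_pow_le 3
  obtain ⟨C₆, hC₆, h₆⟩ := Literature.NumberTheory.Sieve.exists_sum_sigma_zero_pow_le_real 6
  obtain ⟨K₇, hK₇, hK₇eq⟩ : ∃ K : ℝ, 0 < K ∧ (7 : ℝ) ^ (128 : ℕ) = K := ⟨_, by positivity, rfl⟩
  obtain ⟨P₁, hP₁, hP₁eq⟩ : ∃ P : ℝ, 0 < P ∧ (2 : ℝ) ^ (129 : ℕ) = P := ⟨_, by positivity, rfl⟩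
  set c₁ : ℝ := 1800 * 20000 + 25 * 50000 with hc₁
  set c₃ : ℝ := 18 * 20000 + 2 * 50000 with hc₃
  set cA : ℝ := 2 / 3 * (C₃ * 27 * 4 ^ e₃) * c₁ * P₁ with hcA
  set cB : ℝ := 1 / 3 * 343 * (49 * C₆ * K₇) * c₃ * 2 ^ (e₃ + 1) with hcB
  refine ⟨cA + cB, e₃ + 130, by positivity, fun T d₀ hT hd => ?_⟩
  have hT0 : 0 < T := by linarith
  have hd0 : 0 < d₀ := by linarith
  obtain ⟨hl18, hlW, hl6, hl2⟩ := tail_log_bounds hT hd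
  have hl0 : 0 ≤ Real.log T := by linarith
  have hLg0 : 0 ≤ Real.log (18 * T ^ 2 + 2) := Real.log_nonneg (by nlinarith)
  set Q : ℝ := T ^ 3 / d₀ + T ^ 2 with hQ
  have hQ0 : 0 ≤ Q := by positivity
  have hTQ : T ^ 6 / d₀ + T ^ 5 = T ^ 3 * Q := by rw [hQ]; field_simp
  by_cases hW : 18 * T ^ 2 / d₀ < 1
  · rw [TL, TLset_eq_empty hT0 hd0 hW, sum_empty, hTQ]
    exact mul_nonneg (mul_nonneg (by positivity) (by positivity)) (pow_nonneg hl0 _)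
  push Not at hW
  have hlogW0 : 0 ≤ Real.log (18 * T ^ 2 / d₀) := Real.log_nonneg hW
  obtain ⟨hb1, hb2⟩ := bracket_bounds hT hd
  rw [← hQ] at hb1 hb2
  -- Young
  have hY : TL T d₀ ≤ (2 * ∑ bb ∈ TLset T d₀, tauK bb.1 ^ 3 +
      ∑ bb ∈ TLset T d₀, ((σ 0 (hcf3 (cross3 bb.1 bb.2)) : ℝ)) ^ 6) / 3 := by
    rw [TL, two_mul]
    conv_rhs => rw [show (∑ bb ∈ TLset T d₀, tauK bb.1 ^ 3) + (∑ bb ∈ TLset T d₀, tauK bb.1 ^ 3) =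
      (∑ bb ∈ TLset T d₀, tauK bb.1 ^ 3) + (∑ bb ∈ TLset T d₀, tauK bb.2 ^ 3) by
        rw [sum_TLset_snd_eq (fun b => tauK b ^ 3)]]
    rw [← sum_add_distrib, ← sum_add_distrib, sum_div]
    refine sum_le_sum fun bb _ => ?_
    exact young_abc_sq (tauK_nonneg _) (tauK_nonneg _) (Nat.cast_nonneg _)
  -- Term 1
  have hS₃ : ∑ b ∈ cube (3 * T), tauK b ^ 3 ≤ C₃ * (3 * T) ^ 3 * Real.log (2 * (3 * T) + 2) ^ e₃ :=
    h₃ (3 * T) (by linarith)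
  have hS₃' : ∑ b ∈ cube (3 * T), tauK b ^ 3 ≤ C₃ * 27 * 4 ^ e₃ * T ^ 3 * Real.log T ^ e₃ := by
    refine hS₃.trans ?_
    have : Real.log (2 * (3 * T) + 2) ^ e₃ ≤ (4 * Real.log T) ^ e₃ :=
      pow_le_pow_left₀ (Real.log_nonneg (by linarith)) hl6 e₃
    calc C₃ * (3 * T) ^ 3 * Real.log (2 * (3 * T) + 2) ^ e₃ ≤ C₃ * (3 * T) ^ 3 * (4 * Real.log T) ^ e₃ := by gcongr
      _ = C₃ * 27 * 4 ^ e₃ * T ^ 3 * Real.log T ^ e₃ := by rw [mul_pow]; ring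
  have hB₁ : 1800 * T ^ 2 * (512 * (18 * T ^ 2 / d₀) / T + 40 * Real.log (18 * T ^ 2 / d₀) + 42) +
      25 * (64 * (18 * T ^ 2 / d₀) ^ 2 / T + 10 * (18 * T ^ 2 / d₀) + 1) ≤ c₁ * Q * Real.log T := by
    rw [hc₁]; linarith
  have hT1 := sum_TLset_tauK_cube_le hT0 hd0 hW
  have h3nn : 0 ≤ ∑ b ∈ cube (3 * T), tauK b ^ 3 := sum_nonneg fun b _ => by have := tauK_nonneg b; positivity
  have hTerm1 : ∑ bb ∈ TLset T d₀, tauK bb.1 ^ 3 ≤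
      (C₃ * 27 * 4 ^ e₃) * c₁ * (T ^ 3 * Q) * Real.log T ^ (e₃ + 1) := by
    refine hT1.trans ?_
    calc (∑ b ∈ cube (3 * T), tauK b ^ 3) * _ ≤ (∑ b ∈ cube (3 * T), tauK b ^ 3) * (c₁ * Q * Real.log T) :=
          mul_le_mul_of_nonneg_left hB₁ h3nn
      _ ≤ (C₃ * 27 * 4 ^ e₃ * T ^ 3 * Real.log T ^ e₃) * (c₁ * Q * Real.log T) :=
          mul_le_mul_of_nonneg_right hS₃' (by positivity)
      _ = (C₃ * 27 * 4 ^ e₃) * c₁ * (T ^ 3 * Q) * Real.log T ^ (e₃ + 1) := by rw [pow_succ]; ring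
  -- Term 3
  have hT3 := sum_TLset_sigma_le hT0 hd0 hW hC₆ h₆
  have hcube : (#(cube (3 * T)) : ℝ) ≤ 343 * T ^ 3 := by
    refine (card_cube_le (by positivity : (0 : ℝ) ≤ 3 * T)).trans ?_
    nlinarith [pow_le_pow_left₀ (by positivity : (0:ℝ) ≤ 2 * (3 * T) + 1) (by linarith : 2 * (3 * T) + 1 ≤ 7 * T) 3]
  have hbr : 18 * T ^ 2 * (512 * (18 * T ^ 2 / d₀) / T + 40 * Real.log (18 * T ^ 2 / d₀) + 42) +
      2 * (64 * (18 * T ^ 2 / d₀) ^ 2 / T + 10 * (18 * T ^ 2 / d₀) + 1) ≤ c₃ * Q * Real.log T := by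
    rw [hc₃]; linarith
  have hlg : Real.log (18 * T ^ 2 + 2) ^ 128 ≤ K₇ * Real.log T ^ 128 := by
    calc Real.log (18 * T ^ 2 + 2) ^ 128 ≤ (7 * Real.log T) ^ 128 := pow_le_pow_left₀ hLg0 hl18 128
      _ = K₇ * Real.log T ^ 128 := by rw [mul_pow, hK₇eq]
  have hK0 : 0 ≤ 49 * C₆ * Real.log (18 * T ^ 2 + 2) ^ 128 := mul_nonneg (by positivity) (pow_nonneg hLg0 _)
  have hB₃ : 49 * C₆ * Real.log (18 * T ^ 2 + 2) ^ 128 *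
      (18 * T ^ 2 * (512 * (18 * T ^ 2 / d₀) / T + 40 * Real.log (18 * T ^ 2 / d₀) + 42) +
        2 * (64 * (18 * T ^ 2 / d₀) ^ 2 / T + 10 * (18 * T ^ 2 / d₀) + 1)) ≤
      (49 * C₆ * K₇) * c₃ * Q * Real.log T ^ 129 := by
    calc 49 * C₆ * Real.log (18 * T ^ 2 + 2) ^ 128 * _
        ≤ 49 * C₆ * Real.log (18 * T ^ 2 + 2) ^ 128 * (c₃ * Q * Real.log T) := mul_le_mul_of_nonneg_left hbr hK0
      _ ≤ 49 * C₆ * (K₇ * Real.log T ^ 128) * (c₃ * Q * Real.log T) := by gcongr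
      _ = (49 * C₆ * K₇) * c₃ * Q * Real.log T ^ 129 := by
          rw [show (129 : ℕ) = 128 + 1 from rfl, pow_succ]; ring
  have hTerm3 : ∑ bb ∈ TLset T d₀, ((σ 0 (hcf3 (cross3 bb.1 bb.2)) : ℝ)) ^ 6 ≤
      343 * (49 * C₆ * K₇) * c₃ * (T ^ 3 * Q) * Real.log T ^ 129 := by
    refine hT3.trans ?_
    calc (#(cube (3 * T)) : ℝ) * _ ≤ (#(cube (3 * T)) : ℝ) * ((49 * C₆ * K₇) * c₃ * Q * Real.log T ^ 129) :=
          mul_le_mul_of_nonneg_left hB₃ (Nat.cast_nonneg _)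
      _ ≤ (343 * T ^ 3) * ((49 * C₆ * K₇) * c₃ * Q * Real.log T ^ 129) :=
          mul_le_mul_of_nonneg_right hcube (mul_nonneg (by positivity) (pow_nonneg hl0 _))
      _ = 343 * (49 * C₆ * K₇) * c₃ * (T ^ 3 * Q) * Real.log T ^ 129 := by ring
  -- log powers up to `e`
  have hp1 : Real.log T ^ (e₃ + 1) ≤ P₁ * Real.log T ^ (e₃ + 130) := by
    have h := log_pow_le_log_pow hT (show e₃ + 1 ≤ e₃ + 130 by omega)
    rwa [show e₃ + 130 - (e₃ + 1) = 129 by omega, hP₁eq] at h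
  have hp3 : Real.log T ^ 129 ≤ 2 ^ (e₃ + 1) * Real.log T ^ (e₃ + 130) := by
    have h := log_pow_le_log_pow hT (show 129 ≤ e₃ + 130 by omega)
    rwa [show e₃ + 130 - 129 = e₃ + 1 by omega] at h
  have hTQ0 : 0 ≤ T ^ 3 * Q := by positivity
  rw [hTQ]
  have hA : 2 / 3 * ∑ bb ∈ TLset T d₀, tauK bb.1 ^ 3 ≤ cA * (T ^ 3 * Q) * Real.log T ^ (e₃ + 130) := by
    calc 2 / 3 * ∑ bb ∈ TLset T d₀, tauK bb.1 ^ 3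
        ≤ 2 / 3 * ((C₃ * 27 * 4 ^ e₃) * c₁ * (T ^ 3 * Q) * Real.log T ^ (e₃ + 1)) := by gcongr
      _ ≤ 2 / 3 * ((C₃ * 27 * 4 ^ e₃) * c₁ * (T ^ 3 * Q) * (P₁ * Real.log T ^ (e₃ + 130))) := by gcongr
      _ = cA * (T ^ 3 * Q) * Real.log T ^ (e₃ + 130) := by rw [hcA]; ring
  have hB : 1 / 3 * ∑ bb ∈ TLset T d₀, ((σ 0 (hcf3 (cross3 bb.1 bb.2)) : ℝ)) ^ 6 ≤
      cB * (T ^ 3 * Q) * Real.log T ^ (e₃ + 130) := by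
    calc 1 / 3 * ∑ bb ∈ TLset T d₀, ((σ 0 (hcf3 (cross3 bb.1 bb.2)) : ℝ)) ^ 6
        ≤ 1 / 3 * (343 * (49 * C₆ * K₇) * c₃ * (T ^ 3 * Q) * Real.log T ^ 129) := by gcongr
      _ ≤ 1 / 3 * (343 * (49 * C₆ * K₇) * c₃ * (T ^ 3 * Q) * (2 ^ (e₃ + 1) * Real.log T ^ (e₃ + 130))) := by gcongr
      _ = cB * (T ^ 3 * Q) * Real.log T ^ (e₃ + 130) := by rw [hcB]; ring
  calc TL T d₀ ≤ (2 * ∑ bb ∈ TLset T d₀, tauK bb.1 ^ 3 + ∑ bb ∈ TLset T d₀, ((σ 0 (hcf3 (cross3 bb.1 bb.2)) : ℝ)) ^ 6) / 3 := hY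
    _ = 2 / 3 * ∑ bb ∈ TLset T d₀, tauK bb.1 ^ 3 + 1 / 3 * ∑ bb ∈ TLset T d₀, ((σ 0 (hcf3 (cross3 bb.1 bb.2)) : ℝ)) ^ 6 := by
        ring
    _ ≤ cA * (T ^ 3 * Q) * Real.log T ^ (e₃ + 130) + cB * (T ^ 3 * Q) * Real.log T ^ (e₃ + 130) := add_le_add hA hB
    _ = (cA + cB) * (T ^ 3 * Q) * Real.log T ^ (e₃ + 130) := by ring

end Literature.NumberTheory.Sieve.CubicSieve

end
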